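import Mathlib
import Summits.Ventures.PercRepro2.M9NoPocketHarris

/-!
# The quad inequality on the powerset of a finite set (blind cell PercRepro2, p3 g36,
2026-08-29; `proofs/P3-NPHDR.md` §5(f), the form used by the unit assembly)

`M9QuadHarris` states the quad inequality on the hypercube `Finset ι` of a finite type.  The
unit assembly of THEOREM RK-NP sums over the subsets `S ⊆ N` of the `Finset` `N` of JOINED
blocks, so the inequality is restated here on `N.powerset` with the relative complement
`N \ S` in place of `Sᶜ`: for `ℓ` the link indicator (monotone on the subsets of `N`,
`0 ≤ ℓ ≤ 1`, `ℓ ∅ = 0`) and `HY ≤ HW` the two `p ~_Y q` counts (`HW` monotone on the subsets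
of `N`), `2·Σ_{∅ ≠ S ⊊ N} (1 − ℓ S)·(HY S − HW (N ∖ S)) + N₁·(HY ∅ − HW N) ≤ 0` whenever
`N₁ ≥ Σ_{∅ ≠ S ⊆ N} ℓ S` (`quad_sum_nonpos_powerset`; the proper non-empty subsets are spelled out as
`N.powerset.filter (fun S => S ≠ ∅ ∧ S ≠ N)` — no new definition).  The proof is the one of
`quad_sum_nonpos` — `HY ≤ HW`, the antisymmetry `S ↔ N ∖ S`, termwise monotonicity and Harris
on the powerset, the latter from the local sublattice form of `M9NoPocketHarris` with the
involution `S ↦ N ∖ S`.  Own work; std axioms.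
-/

namespace Summit.Ventures.PercRepro2

namespace M9Reduce

open Finset

variable {β : Type*} [DecidableEq β]

/-- Membership in the proper non-empty subsets. -/
lemma mem_properOf {N S : Finset β} :
    S ∈ N.powerset.filter (fun S => S ≠ ∅ ∧ S ≠ N) ↔ S ⊆ N ∧ S ≠ ∅ ∧ S ≠ N := by
  simp

/-- The relative complement of a proper non-empty subset is proper and non-empty. -/
lemma sdiff_mem_properOf {N S : Finset β}
    (h : S ∈ N.powerset.filter (fun S => S ≠ ∅ ∧ S ≠ N)) :
    N \ S ∈ N.powerset.filter (fun S => S ≠ ∅ ∧ S ≠ N) := by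
  rw [mem_properOf] at h ⊢
  obtain ⟨hS, hne, hnN⟩ := h
  refine ⟨Finset.sdiff_subset, ?_, ?_⟩
  · intro h0
    exact hnN (Finset.Subset.antisymm hS (Finset.sdiff_eq_empty_iff_subset.1 h0))
  · intro h1
    apply hne
    rw [Finset.eq_empty_iff_forall_notMem]
    intro x hx
    have hx' : x ∈ N \ S := by rw [h1]; exact hS hx
    exact (Finset.mem_sdiff.1 hx').2 hx

/-- An antisymmetric function sums to zero over the proper subsets. -/
lemma sum_properOf_sub_sdiff (N : Finset β) (F : Finset β → ℤ) :
    ∑ S ∈ N.powerset.filter (fun S => S ≠ ∅ ∧ S ≠ N), (F S - F (N \ S)) = 0 := by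
  rw [Finset.sum_sub_distrib]
  have : ∑ S ∈ N.powerset.filter (fun S => S ≠ ∅ ∧ S ≠ N), F (N \ S) =
      ∑ S ∈ N.powerset.filter (fun S => S ≠ ∅ ∧ S ≠ N), F S := by
    refine Finset.sum_nbij' (fun S => N \ S) (fun S => N \ S) (fun S hS => sdiff_mem_properOf hS)
      (fun S hS => sdiff_mem_properOf hS)
      (fun S hS => Finset.sdiff_sdiff_eq_self (mem_properOf.1 hS).1)
      (fun S hS => Finset.sdiff_sdiff_eq_self (mem_properOf.1 hS).1) (fun S _ => rfl)
  rw [this, sub_self]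

/-- Harris on the powerset of `N`, in the form used here: for `ℓ`, `HW` monotone on the
subsets of `N`, `Σ_{S ⊆ N} ℓ S · (HW (N ∖ S) − HW S) ≤ 0`. -/
lemma sum_link_mul_sub_nonpos_powerset [Fintype β] (N : Finset β) {ℓ HW : Finset β → ℤ}
    (hℓ : ∀ S ⊆ N, ∀ T ⊆ N, S ⊆ T → ℓ S ≤ ℓ T)
    (hW : ∀ S ⊆ N, ∀ T ⊆ N, S ⊆ T → HW S ≤ HW T) :
    ∑ S ∈ N.powerset, ℓ S * (HW (N \ S) - HW S) ≤ 0 := by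
  have h := NoPocket.sum_sub_dual_mul_nonpos_of_sublattice'' (L := N.powerset)
    (c := fun S => N \ S)
    (fun S hS => Finset.sdiff_sdiff_eq_self (Finset.mem_powerset.1 hS))
    (fun S T hST => Finset.sdiff_subset_sdiff (Finset.Subset.refl N) hST)
    (fun S T hS hT => by
      rw [Finset.mem_powerset, Finset.sup_eq_union]
      exact Finset.union_subset (Finset.mem_powerset.1 hS) (Finset.mem_powerset.1 hT))
    (fun S T hS _ => by
      rw [Finset.mem_powerset, Finset.inf_eq_inter]
      exact Finset.inter_subset_left.trans (Finset.mem_powerset.1 hS))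
    (fun S _ => Finset.mem_powerset.2 Finset.sdiff_subset)
    (G := HW) (H := fun S => -ℓ S)
    (fun S hS T hT hST => hW S (Finset.mem_powerset.1 hS) T (Finset.mem_powerset.1 hT) hST)
    (fun S hS T hT hST => by
      simp only [neg_le_neg_iff]
      exact hℓ S (Finset.mem_powerset.1 hS) T (Finset.mem_powerset.1 hT) hST)
  have heq : ∑ S ∈ N.powerset, ℓ S * (HW (N \ S) - HW S) =
      ∑ S ∈ N.powerset, (HW S - HW ((fun S => N \ S) S)) * (fun S => -ℓ S) S := by
    refine Finset.sum_congr rfl (fun S _ => ?_)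
    ring
  rw [heq]
  exact h

/-- The powerset of a non-empty `N` is `∅`, `N` and the proper non-empty subsets. -/
lemma powerset_eq_insert_properOf {N : Finset β} (hN : N ≠ ∅) :
    N.powerset =
      insert (∅ : Finset β) (insert N (N.powerset.filter (fun S => S ≠ ∅ ∧ S ≠ N))) := by
  ext S
  simp only [Finset.mem_powerset, Finset.mem_insert, mem_properOf]
  constructor
  · intro hS
    by_cases h0 : S = ∅
    · exact Or.inl h0
    by_cases h1 : S = N
    · exact Or.inr (Or.inl h1)
    exact Or.inr (Or.inr ⟨hS, h0, h1⟩)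
  · rintro (rfl | rfl | ⟨hS, _, _⟩)
    · exact Finset.empty_subset _
    · exact Finset.Subset.refl _
    · exact hS

/-- `N` is not a proper subset of itself. -/
lemma self_notMem_properOf (N : Finset β) :
    N ∉ N.powerset.filter (fun S => S ≠ ∅ ∧ S ≠ N) := by
  rw [mem_properOf]
  tauto

/-- `∅` is neither `N` (non-empty) nor proper. -/
lemma empty_notMem_insert_properOf {N : Finset β} (hN : N ≠ ∅) :
    (∅ : Finset β) ∉ insert N (N.powerset.filter (fun S => S ≠ ∅ ∧ S ≠ N)) := by
  simp only [Finset.mem_insert, mem_properOf, not_or]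
  exact ⟨fun h => hN h.symm, fun h => h.2.1 rfl⟩

/-- The non-empty subsets of a non-empty `N` are `N` and the proper non-empty subsets. -/
lemma filter_ne_empty_eq_insert_properOf {N : Finset β} (hN : N ≠ ∅) :
    N.powerset.filter (fun S => S ≠ ∅) =
      insert N (N.powerset.filter (fun S => S ≠ ∅ ∧ S ≠ N)) := by
  ext S
  simp only [Finset.mem_filter, Finset.mem_powerset, Finset.mem_insert]
  constructor
  · rintro ⟨hS, h0⟩
    by_cases h1 : S = N
    · exact Or.inl h1
    · exact Or.inr ⟨hS, h0, h1⟩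
  · rintro (rfl | ⟨hS, h0, _⟩)
    · exact ⟨Finset.Subset.refl _, hN⟩
    · exact ⟨hS, h0⟩

/-- **The quad inequality on the powerset of `N`.** -/
theorem quad_sum_nonpos_powerset [Fintype β] (N : Finset β) {ℓ HY HW : Finset β → ℤ}
    (hℓ : ∀ S ⊆ N, ∀ T ⊆ N, S ⊆ T → ℓ S ≤ ℓ T) (hℓ0 : ∀ S, 0 ≤ ℓ S)
    (hℓ1 : ∀ S, ℓ S ≤ 1) (hℓe : ℓ ∅ = 0)
    (hW : ∀ S ⊆ N, ∀ T ⊆ N, S ⊆ T → HW S ≤ HW T) (hYW : ∀ S, HY S ≤ HW S) {N₁ : ℤ}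
    (hN₁ : ∑ S ∈ N.powerset.filter (fun S => S ≠ ∅), ℓ S ≤ N₁) :
    2 * (∑ S ∈ N.powerset.filter (fun S => S ≠ ∅ ∧ S ≠ N),
        (1 - ℓ S) * (HY S - HW (N \ S))) + N₁ * (HY ∅ - HW N) ≤ 0 := by
  have hsum0 : 0 ≤ ∑ S ∈ N.powerset.filter (fun S => S ≠ ∅), ℓ S :=
    Finset.sum_nonneg (fun S _ => hℓ0 S)
  have hN₁0 : 0 ≤ N₁ := hsum0.trans hN₁
  have hneg : HY ∅ - HW N ≤ 0 := by
    have := hYW ∅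
    have := hW ∅ (Finset.empty_subset N) N (Finset.Subset.refl N) (Finset.empty_subset N)
    linarith
  by_cases hN : N = ∅
  · -- no proper subsets: only the one-sided term, which is `≤ 0`
    have hP : N.powerset.filter (fun S => S ≠ ∅ ∧ S ≠ N) = ∅ := by
      rw [Finset.eq_empty_iff_forall_notMem]
      intro S hS
      obtain ⟨hS, h0, _⟩ := mem_properOf.1 hS
      rw [hN, Finset.subset_empty] at hS
      exact h0 hS
    rw [hP, Finset.sum_empty, mul_zero, zero_add]
    exact mul_nonpos_of_nonneg_of_nonpos hN₁0 hneg
  -- Step 1: `HY ≤ HW` in the doubly-reached part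
  have h1 : ∑ S ∈ N.powerset.filter (fun S => S ≠ ∅ ∧ S ≠ N), (1 - ℓ S) * (HY S - HW (N \ S)) ≤
      ∑ S ∈ N.powerset.filter (fun S => S ≠ ∅ ∧ S ≠ N), (1 - ℓ S) * (HW S - HW (N \ S)) := by
    refine Finset.sum_le_sum (fun S _ => ?_)
    have := hℓ1 S
    have := hYW S
    nlinarith
  -- Step 2: antisymmetry turns `(1 − ℓ)` into `−ℓ`
  have h2 : ∑ S ∈ N.powerset.filter (fun S => S ≠ ∅ ∧ S ≠ N), (1 - ℓ S) * (HW S - HW (N \ S)) =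
      ∑ S ∈ N.powerset.filter (fun S => S ≠ ∅ ∧ S ≠ N), ℓ S * (HW (N \ S) - HW S) := by
    have hz := sum_properOf_sub_sdiff N HW
    have : ∑ S ∈ N.powerset.filter (fun S => S ≠ ∅ ∧ S ≠ N), (1 - ℓ S) * (HW S - HW (N \ S)) =
        ∑ S ∈ N.powerset.filter (fun S => S ≠ ∅ ∧ S ≠ N), (HW S - HW (N \ S)) +
          ∑ S ∈ N.powerset.filter (fun S => S ≠ ∅ ∧ S ≠ N), ℓ S * (HW (N \ S) - HW S) := by
      rw [← Finset.sum_add_distrib]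
      refine Finset.sum_congr rfl (fun S _ => ?_)
      ring
    rw [this, hz, zero_add]
  -- Step 3: the one-sided part, `HY ∅ ≤ HW ∅` and `N₁` at least the number of linking sets
  have h3 : N₁ * (HY ∅ - HW N) ≤
      (∑ S ∈ N.powerset.filter (fun S => S ≠ ∅), ℓ S) * (HW ∅ - HW N) := by
    have hYW0 := hYW ∅
    nlinarith [mul_le_mul_of_nonpos_right hN₁ hneg]
  -- Step 4: the termwise bound on the proper subsets, and the two corners
  have hsplit : ∑ S ∈ N.powerset.filter (fun S => S ≠ ∅), ℓ S =
      ∑ S ∈ N.powerset.filter (fun S => S ≠ ∅ ∧ S ≠ N), ℓ S + ℓ N := by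
    rw [filter_ne_empty_eq_insert_properOf hN, Finset.sum_insert (self_notMem_properOf N)]
    ring
  have h4 : ∑ S ∈ N.powerset.filter (fun S => S ≠ ∅ ∧ S ≠ N),
      (2 * (ℓ S * (HW (N \ S) - HW S)) + ℓ S * (HW ∅ - HW N)) ≤
      ∑ S ∈ N.powerset.filter (fun S => S ≠ ∅ ∧ S ≠ N), ℓ S * (HW (N \ S) - HW S) := by
    refine Finset.sum_le_sum (fun S hS => ?_)
    have hSN : S ⊆ N := (mem_properOf.1 hS).1
    have ha := hW ∅ (Finset.empty_subset N) S hSN (Finset.empty_subset S)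
    have hb := hW (N \ S) Finset.sdiff_subset N (Finset.Subset.refl N) Finset.sdiff_subset
    have := hℓ0 S
    nlinarith
  have hall : ∑ S ∈ N.powerset, ℓ S * (HW (N \ S) - HW S) =
      ∑ S ∈ N.powerset.filter (fun S => S ≠ ∅ ∧ S ≠ N), ℓ S * (HW (N \ S) - HW S) + ℓ N * (HW ∅ - HW N) := by
    conv_lhs => rw [powerset_eq_insert_properOf hN]
    rw [Finset.sum_insert (empty_notMem_insert_properOf hN),
      Finset.sum_insert (self_notMem_properOf N), hℓe, Finset.sdiff_self, Finset.sdiff_empty]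
    ring
  have hH := sum_link_mul_sub_nonpos_powerset N hℓ hW
  rw [hall] at hH
  -- assemble
  have hsum4 : ∑ S ∈ N.powerset.filter (fun S => S ≠ ∅ ∧ S ≠ N),
      (2 * (ℓ S * (HW (N \ S) - HW S)) + ℓ S * (HW ∅ - HW N)) =
      2 * ∑ S ∈ N.powerset.filter (fun S => S ≠ ∅ ∧ S ≠ N), ℓ S * (HW (N \ S) - HW S) +
        (∑ S ∈ N.powerset.filter (fun S => S ≠ ∅ ∧ S ≠ N), ℓ S) * (HW ∅ - HW N) := by
    rw [Finset.sum_add_distrib, ← Finset.mul_sum, Finset.sum_mul]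
  rw [hsplit] at h3
  nlinarith [h1, h2, h3, h4, hH, hsum4]

end M9Reduce

end Summit.Ventures.PercRepro2
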